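import Summits.Ventures.HSemireg.ComponentLadderG2nCofinal
import Summits.Ventures.HSemireg.S4BridgeWeilFamilyReachSimilar
import Summits.Ventures.HSemireg.Statement
import HarnessLib

/-!
# Venture HSemireg — the `g = 2n` assembly over ONE constructor package: Deligne's period-surjective polarized Weil systems
# (s4-bridge-2's (PWS)+[U], tree theorem p368154) in place of BOTH named reach facts `weilFamilyReach_similar` ∕ `weilFamilyReach_hyperbolic`

HONEST FRAMING. Assembly leaf of a COMPUTATION cell (`pub-hsemireg`, Sunday typer seat p11 «assembly, g = 2n», fifth generation; referees
ref-3 ∕ ref-4; companions `ComponentLadderG2n.lean` (p364174), `ComponentLadderG2nCofinal.lean` (p367857), `Statement.lean`). Lean INDEX only: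
every theorem is an IMPLICATION whose published inputs appear BY NAME, whose objects appear BY VALUE, and whose family-theoretic input is ONE
HYPOTHESIS PACKAGE stated inline. Nothing here says HC ∕ HC_CM ∕ HC_AV is proved; no object of the cell is certified; the package is NOT
discharged (the tree constructs no moduli space of polarized abelian varieties, no universal abelian scheme, no period map).

## Why this leaf
Every end statement of the cell and of this seat's ladder (`Statement.lean`, `Transfer.lean`, `ComponentCells*.lean`, `AmplificationChainG2n*`,
`StructureLadderG2n`, `ComponentLadderG2n{,Cofinal}`, `VerdictAssemblyG6`, seat p5's tower) takes Deligne's reach BY NAME — the REFEREED named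
facts `HodgeTheory.weilFamilyReach_similar` (reach-by-similitude) and `HodgeTheory.weilFamilyReach_hyperbolic` (split component), both UNPROVED in
the tree; `ComponentLadderG2nCofinal` §4 showed the first alone suffices (`weilFamilyReach_hyperbolic_of_similar`). Seat s4-bridge-2's leaf
`S4BridgeWeilFamilyReachSimilar.lean` (p368154, tree sha256∕16 `7ce38f54657c9c45`) proves BOTH named facts from ONE package (PWS)+[U]:
«through every Weil-type polarized `(P, ψ₀, h_K)`, `h_K = d·e^*a + ψ₀^*e^*a`: a polarized Weil system — smooth projective family
`f : 𝒳 → S` of relative dimension `2n` in `ℙᴺ × S` over an irreducible smooth quasi-projective base, fibre charts by abelian `2n`-folds with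
`Ψ_s² = -d`, a flat `(n, n)` Weil section through every Weil class of `(P, ψ₀)`, a polarization class restricting to `h_K` — PERIOD-SURJECTIVE at
`(P, ψ₀, h_K)`» ([Deligne1982HodgeCycles] proof of Thm. 4.8 (a)–(c) with [U]; NO reach clause, NO Riemann hypothesis, NO hyperbolicity). This
leaf composes: the package REPLACES both reach binders throughout the assembly. After it, the inputs of the cell's end statements are — BY NAME —
the TRANSFER statement of the object class (`LocalVariationalHodgeFor 𝒪`; in §1 the three doors `BlochSemiregularSpread`,
`BlochSemiregularSpreadSmoothComponents`, `BuchweitzFlenner2003_variationalHodge_ISemiregular`; in §3 the venture's `PerfectComplexRankTransfer C` ∕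
`PerfectComplexSigmaTransfer C`; Moonen–Zarhin where stated), — BY VALUE — the SEEDS (the cell's computation targets), and — INLINE — the package,
a CONSTRUCTOR'S OBLIGATION (what a builder of Deligne's ∕ Mumford's family owes), not a statement about Hodge classes.

## What is proved (0 sorry, 0 def, 0 named fact introduced; every proof a one-line composition of tree theorems)
* §1 the cell's two STATEMENTS OF RECORD (`Statement.lean`: split component ∕ the anchor's own component, any of the three object kinds) over
  the package;
* §2 the component ladder (a seed on a member of ANY component `(N, d, δ)` ⟹ that component ∧ everything below), its component-free form,
  R∞ `WeilClassesImaginaryQuadratic` from cofinal seeded members, seat p5's tower with Moonen–Zarhin BY NAME, the GENERAL members of every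
  component (`Ring2Transport.HodgeGeneralWeilType`, van Geemen 6.12), and STRUCTURE (S4) in seat p10's spelling — all over the package;
* §3 route (C) on real carriers (rank door, σ-door) over the package;
* §4 the companions' SPLIT-anchored sentences (level-`N` split ladder, (S4) with split seeds) over the package.

## AS PRINTED — citation record (inherited from the composed theorems; nothing new is read here)
* P. Deligne (notes by J. S. Milne), *Hodge cycles on abelian varieties*, LNM 900 (1982), §4: Prop. 4.1, Cor. 4.2, Prop. 4.4, Thm. 4.8 and
  its proof, clauses (a)–(c), «Note that `A` is a member of the family» (Milne's TeXed ed., rev. 2018, pp. 32–35) — the package and the two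
  reach facts it yields (s4-bridge-2). [cite: Deligne1982HodgeCycles, §4 Prop. 4.1, Cor. 4.2, Prop. 4.4 and proof of Thm. 4.8, clauses (a)–(c) (Milne's TeXed ed., rev. 2018, pp. 32–35)]
* B. van Geemen, LNM 1594 (1994): 4.9, Lemma 5.2 (1)–(4), 5.3–5.5, (5.4.1), 5.8–5.11, Thm. 6.11–6.12. [cite: vanGeemen1994HodgeAV, 4.9, Lemma 5.2 (1)–(4), 5.3–5.5, 5.8–5.11 and Thm. 6.11–6.12]
* W. Landherr (1936); Deligne–Milne, LNM 900 II Thm. 6.20 (Riemann's theorem as the tree theorem `hodgeIso_bettiOne_isogeny`) — inside p368154.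
  [cite: Landherr1936HermitianForms] [cite: DeligneMilne1982Tannakian, Thm. 6.20]
* C. Schoen, Addendum (1998), ¶10 (Proposition), p. 332 — the descent below the seed level (s4-bridge-2's ladder, tree theorems).
  [cite: Schoen1998HodgeWeilAddendum, 10 (Proposition), p. 332]
* S. Bloch, Invent. Math. 17 (1972), Thm. (7.4), Remark (7.5); R.-O. Buchweitz, H. Flenner, Compositio 137 (2003), Thm. 5.1–5.2 — the doors of §1,
  BY NAME. [cite: Bloch1972Semiregularity, Thm. (7.4) and Remark (7.5)] [cite: BuchweitzFlenner2003, Thm. 5.1 and Thm. 5.2]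
* A. Weil (1977) §3; B. Moonen, Yu. Zarhin, Duke Math. J. 77 (1999), Thm. 0.1–0.2; E. Markman, arXiv:2509.23403, Thm. 1.2, Cor. 1.3, §11.5, §12
  (survey, UNREFEREED). [cite: Weil1977HodgeRing, §3] [cite: MoonenZarhin1999LowDim, Thm. 0.1 and Thm. 0.2] [cite: Markman2025SurveySecant, Thm. 1.2, Cor. 1.3, §11.5 Steps 1–2 and §12 (preprint)]

## Rendering and scope (readings NAMED)
The package `hPWS` below is VERBATIM the hypothesis `h` of `weilFamilyReach_similar_of_polarizedWeilSystems_of_periodSurjective` (and of its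
hyperbolic twin) in `S4BridgeWeilFamilyReachSimilar.lean`; it is a HYPOTHESIS of every theorem of this file (a section binder, `include`d), never
asserted. «Reaches» inside it = isogeny pair with a fibre chart (isogenous, not isomorphic). The package asks a family through EVERY Weil-type
polarized point (typed ⊇ what each consumer uses). The named facts `weilFamilyReach_similar` ∕ `weilFamilyReach_hyperbolic` do not occur as
binders here; they are DERIVED from `hPWS` inside each proof by p368154 and stay unproved as closed statements. No census row supplies a seed
on a deciding component (VERDICT-G6 v1.0: «NO-in-families-tried» at g = 6 ∕ g = 8, «no witness» at g = 10); nothing is instantiated.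
-/

noncomputable section

open CategoryTheory CategoryTheory.Limits AlgebraicGeometry Set
open scoped TensorProduct
open Literature.AlgebraicGeometry Literature.AlgebraicGeometry.Motives Literature.AlgebraicGeometry.Modules
open Literature.AlgebraicGeometry.HodgeTheory Literature.AlgebraicGeometry.KTheory
open Literature.AlgebraicGeometry.ModuliOfAbelianVarieties Literature.AlgebraicGeometry.Deligne1982
open Literature.AlgebraicGeometry.VanGeemen1994
open Literature.AlgebraicTopology.SingularHomology

namespace Summit.Ventures.HSemireg

open Summit.HodgeConjecture.HodgeConjecture
open Summit.HodgeConjecture.HodgeConjecture.WeilTypeLadder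
open Summit.HodgeConjecture.HodgeConjecture.Cruxes.HodgeAbelianVarieties.EStepSecantInduction
open Summit.HodgeConjecture.HodgeConjecture.Ring2.Hypotheses
open Summit.HodgeConjecture.HodgeConjecture.Ring2.AbelianAll
open Summit.Ventures.HSemireg.GeneralStructure
open Summit.Ventures.HSemireg.FormulaN.Uniform (S4Conjecture)

section OnePackage

/- THE PACKAGE (PWS)+[U] — VERBATIM the hypothesis `h` of s4-bridge-2's `weilFamilyReach_similar_of_polarizedWeilSystems_of_periodSurjective`
(`S4BridgeWeilFamilyReachSimilar.lean`, p368154): for all `n, d ≥ 1` and every Weil-type `(P, ψ₀)` of type `(n, d)` with a projective embedding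
`e` and a rational hyperplane datum `a ≠ 0`, a polarized Weil system through `P ≅ 𝒳_{s₀}` with flat `(n, n)` Weil sections through every Weil
class and polarization class restricting to `h_K = d·e^*a + ψ₀^*e^*a`, PERIOD-SURJECTIVE at `(P, ψ₀, h_K)` ([U]). A HYPOTHESIS, `include`d in
every theorem of this section. -/
variable (hPWS : ∀ (n d : ℕ), 1 ≤ n → 1 ≤ d →
      ∀ (P : AbelianVariety ℂ) (ψ₀ : P ⟶ P) (e : ProjectiveEmbedding P.X)
        (a : complexBetti (projectiveSpace e.n ℂ) 2),
        P.dim = 2 * n → ∀ (ha : IsRationalClass a) (ha0 : a ≠ 0), IsWeilType P ψ₀ n d →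
        ∃ (𝒳 S : SchemeOver ℂ) (f : 𝒳 ⟶ S) (s₀ : ComplexPoints S) (e' : P.X ≅ fiberOver f s₀)
          (Y : ComplexPoints S → AbelianVariety ℂ) (Ψ : ∀ s, Y s ⟶ Y s)
          (ε : ∀ s, (Y s).X ≅ fiberOver f s) (H : complexBetti 𝒳 2),
          IsSmoothProjectiveFamily f (2 * n) ∧
          (∃ (N : ℕ) (ι : 𝒳 ⟶ CategoryTheory.MonoidalCategoryStruct.tensorObj (projectiveSpace N ℂ) S),
            AlgebraicGeometry.IsClosedImmersion ι.left ∧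
              ι ≫ CategoryTheory.CartesianMonoidalCategory.snd (projectiveSpace N ℂ) S = f) ∧
          IrreducibleSpace S.left ∧ AlgebraicGeometry.Smooth S.hom ∧ IsQuasiProjectiveOver S ∧
          (∀ s, (Y s).dim = 2 * n ∧ Ψ s ≫ Ψ s = -((d : ℤ) • 𝟙 (Y s))) ∧
          (∀ w : complexBetti P.X (2 * n), w ∈ weilClassesOf P ψ₀ n d →
            ∃ σ : ComplexPoints S → FiberClass f (2 * n),
              Continuous σ ∧ σ s₀ = ⟨s₀, complexBetti.map e'.inv (2 * n) w⟩ ∧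
              ∀ s, ∃ x : complexBetti (fiberOver f s) (2 * n), σ s = ⟨s, x⟩ ∧
                IsOfHodgeType (2 * n) (fiberOver f s) (2 * n) n n x ∧
                complexBetti.map (ε s).hom (2 * n) x ∈ weilClassesOf (Y s) (Ψ s) n d) ∧
          (∀ s : ComplexPoints S,
            IsRationalClass (complexBetti.map (fiberι f s) 2 H) ∧
              IsOfHodgeType (2 * n) (fiberOver f s) 2 1 1 (complexBetti.map (fiberι f s) 2 H)) ∧
          complexBetti.map e'.hom 2 (complexBetti.map (fiberι f s₀) 2 H) =
            (d : ℂ) • complexBetti.map e.ι 2 a + complexBetti.map ψ₀.hom.hom.hom 2 (complexBetti.map e.ι 2 a) ∧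
          (∃ (m : ℕ) (hm : 1 ≤ m) (hPm : P.dim = m + 1) (hd' : 0 < d) (hψ : ψ₀ ≫ ψ₀ = -(d • 𝟙 P))
              (ω : complexBetti P.X (2 + 2 * m)) (hω : IsRationalClass ω) (hω0 : ω ≠ 0),
            ∀ (J : (weilDatumOfKsymm hm hPm hd' hψ e ha ha0 hω hω0).Cx →ₗ[ℂ]
                (weilDatumOfKsymm hm hPm hd' hψ e ha ha0 hω hω0).Cx)
              (hW : Motives.IsWeilComplexStructure (weilDatumOfKsymm hm hPm hd' hψ e ha ha0 hω hω0).hForm J),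
              ∃ (s : ComplexPoints S) (β : bettiCohomology P.X 1 ≃ₗ[ℚ] bettiCohomology (Y s).X 1),
                (∀ x, β (bettiCohomology.map ψ₀.hom.hom.hom 1 x) =
                  bettiCohomology.map (Ψ s).hom.hom.hom 1 (β x)) ∧
                ∀ x ∈ ((weilDatumOfKsymm hm hPm hd' hψ e ha ha0 hω hω0).hodgeStructure J hW.sq).piece 1 0,
                  IsOfHodgeType (2 * n) (Y s).X 1 1 0
                    (Motives.ofRatClassBaseChange (ComplexPoints (Y s).X) 1 (β.toLinearMap.baseChange ℂ x))))
include hPWS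

variable {𝒪 : ObjClass}

/-! ## §1 The cell's STATEMENTS OF RECORD (`Statement.lean`) over the package -/

/-- **Statement of record, SPLIT component, any of the three object kinds — over ONE package.** `Statement.weilClasses_algebraic_split_of_any_seed`
with its binder `hF : weilFamilyReach_hyperbolic` REPLACED by the package (`weilFamilyReach_hyperbolic_of_polarizedWeilSystems_of_periodSurjective`,
s4-bridge-2). BY NAME: the three doors' transport facts (`BlochSemiregularSpread (2n) n`, `BlochSemiregularSpreadSmoothComponents (2n) n`,
`BuchweitzFlenner2003_variationalHodge_ISemiregular`); BY VALUE: a split `√-d`-Weil anchor `(P, ψ₀, ι, a)` of dimension `2n` with a non-zero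
rational Weil class `w` and ONE certified object for it (integral Bloch seed ∕ reduced union seed ∕ `I`-semiregular vector bundle); INLINE: the
package. CONCLUSION: the Weil plane of every split `√-d`-Weil abelian `2n`-fold is algebraic. Nothing instantiated.
[cite: Bloch1972Semiregularity, Thm. (7.4) and Remark (7.5)] [cite: BuchweitzFlenner2003, Thm. 5.1 and Thm. 5.2]
[cite: Deligne1982HodgeCycles, §4 Cor. 4.2, Prop. 4.4 and proof of Thm. 4.8, clauses (a)–(c) (Milne's TeXed ed., rev. 2018, pp. 32–35)] -/
theorem weilClasses_algebraic_split_of_any_seed_of_weilSystems (n d : ℕ) (hn : 1 ≤ n) (hd : 1 ≤ d)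
    (hB : BlochSemiregularSpread (2 * n) n) (hB' : BlochSemiregularSpreadSmoothComponents (2 * n) n)
    (hBF : BuchweitzFlenner2003_variationalHodge_ISemiregular)
    (P : AbelianVariety ℂ) (ψ₀ : P ⟶ P) (ι : ProjectiveEmbedding P.X) (a : complexBetti (projectiveSpace ι.n ℂ) 2)
    (w : complexBetti P.X (2 * n)) (hP : P.dim = 2 * n) (hψ : ψ₀ ≫ ψ₀ = -(d • 𝟙 P)) (ha : IsRationalClass a)
    (ha0 : a ≠ 0) (hhyp : IsHyperbolicWeilType P ψ₀ n (symmetrisedClass d P ψ₀ ι a))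
    (hwW : w ∈ weilClassesOf P ψ₀ n d) (hwr : IsRationalClass w) (hw0 : w ≠ 0)
    (hseed : HasBlochSeedAt n P (symmetrisedClass d P ψ₀ ι a) w ∨
      HasBlochUnionSeedAt n P (symmetrisedClass d P ψ₀ ι a) w ∨
      ∃ (C : ChernCharacterBetti) (I : Finset ℕ), HasBFSheafSeedAt C n I P (symmetrisedClass d P ψ₀ ι a) w)
    (A : AbelianVariety ℂ) (φ : A ⟶ A) (hA : A.dim = 2 * n) (hφ : φ ≫ φ = -(d • 𝟙 A))
    (eA : ProjectiveEmbedding A.X) (aA : complexBetti (projectiveSpace eA.n ℂ) 2) (haA : IsRationalClass aA)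
    (haA0 : aA ≠ 0) (hhypA : IsHyperbolicWeilType A φ n (symmetrisedClass d A φ eA aA)) :
    weilClassesOf A φ n d ≤ algebraicClasses A.X n :=
  weilClasses_algebraic_split_of_any_seed n d hn hd hB hB' hBF
    (weilFamilyReach_hyperbolic_of_polarizedWeilSystems_of_periodSurjective hPWS) P ψ₀ ι a w hP hψ ha ha0 hhyp hwW hwr hw0
    hseed A φ hA hφ eA aA haA haA0 hhypA

/-- **Statement of record, the anchor's OWN component, any of the three object kinds — over ONE package.**
`Statement.weilClasses_algebraic_of_similar_any_seed` with its binder `hF : weilFamilyReach_similar` REPLACED by the package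
(`weilFamilyReach_similar_of_polarizedWeilSystems_of_periodSurjective`, s4-bridge-2). BY NAME: the three doors' transport facts; BY VALUE: a
`√-d`-Weil anchor (split OR not) with a non-zero rational `(n,n)` Weil class `w` and ONE certified object for it; INLINE: the package. CONCLUSION:
the Weil plane of every `√-d`-Weil `2n`-fold carrying a non-zero `(n,n)` Weil class and Weil-SIMILAR to the anchor is algebraic — at `n = 3` on a
NON-split anchor, the cell's first open target. Nothing instantiated. [cite: Bloch1972Semiregularity, Thm. (7.4) and Remark (7.5)]
[cite: BuchweitzFlenner2003, Thm. 5.1 and Thm. 5.2] [cite: Deligne1982HodgeCycles, §4 Prop. 4.1, Prop. 4.4 and proof of Thm. 4.8, clauses (a)–(c) (Milne's TeXed ed., rev. 2018, pp. 32–35)]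
[cite: Landherr1936HermitianForms] -/
theorem weilClasses_algebraic_of_similar_any_seed_of_weilSystems {n d : ℕ} (hn : 1 ≤ n) (hd : 1 ≤ d)
    (hB : BlochSemiregularSpread (2 * n) n) (hB' : BlochSemiregularSpreadSmoothComponents (2 * n) n)
    (hBF : BuchweitzFlenner2003_variationalHodge_ISemiregular)
    (P : AbelianVariety ℂ) (ψ₀ : P ⟶ P) (ι : ProjectiveEmbedding P.X) (a : complexBetti (projectiveSpace ι.n ℂ) 2)
    (w : complexBetti P.X (2 * n)) (hP : P.dim = 2 * n) (hψ : ψ₀ ≫ ψ₀ = -(d • 𝟙 P)) (ha : IsRationalClass a)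
    (ha0 : a ≠ 0) (hwW : w ∈ weilClassesOf P ψ₀ n d) (hwr : IsRationalClass w) (hw0 : w ≠ 0)
    (hwH : IsOfHodgeType (2 * n) P.X (2 * n) n n w)
    (hseed : HasBlochSeedAt n P (symmetrisedClass d P ψ₀ ι a) w ∨
      HasBlochUnionSeedAt n P (symmetrisedClass d P ψ₀ ι a) w ∨
      ∃ (C : ChernCharacterBetti) (I : Finset ℕ), HasBFSheafSeedAt C n I P (symmetrisedClass d P ψ₀ ι a) w)
    (A : AbelianVariety ℂ) (φ : A ⟶ A) (hA : A.dim = 2 * n) (hφ : φ ≫ φ = -(d • 𝟙 A))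
    (hWA : ∃ wA : complexBetti A.X (2 * n),
      wA ∈ weilClassesOf A φ n d ∧ wA ≠ 0 ∧ IsOfHodgeType (2 * n) A.X (2 * n) n n wA)
    (eA : ProjectiveEmbedding A.X) (aA : complexBetti (projectiveSpace eA.n ℂ) 2) (haA : IsRationalClass aA)
    (haA0 : aA ≠ 0)
    (hsim : IsWeilSimilar n P ψ₀ (symmetrisedClass d P ψ₀ ι a) A φ (symmetrisedClass d A φ eA aA)) :
    weilClassesOf A φ n d ≤ algebraicClasses A.X n :=
  weilClasses_algebraic_of_similar_any_seed hn hd hB hB' hBF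
    (weilFamilyReach_similar_of_polarizedWeilSystems_of_periodSurjective hPWS) P ψ₀ ι a w hP hψ ha ha0 hwW hwr hw0 hwH
    hseed A φ hA hφ hWA eA aA haA haA0 hsim

/-! ## §2 The component ladder, R∞, the Moonen–Zarhin tower, the general members and STRUCTURE (S4) over the package -/

/-- **The component ladder over ONE package.** `ComponentLadderG2n.componentLadder_of_localVariationalHodgeFor_of_seedOn_member` with
`hF : weilFamilyReach_similar` REPLACED by the package. BY NAME `LocalVariationalHodgeFor 𝒪`; BY VALUE a polarized member `(P, ψ₀, h_K)` of Weil
type `(N, d)` of the component `(N, d, δ)`, a non-zero rational Weil class `w`, ONE seed of class `𝒪`; INLINE the package. CONCLUSION: the member's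
component ∧ every component `(n, d, δ')` and `WeilAlgebraicAll n d` for every `1 ≤ n < N` (Schoen's Proposition iterated — tree theorems).
[cite: Schoen1998HodgeWeilAddendum, 10 (Proposition), p. 332] [cite: vanGeemen1994HodgeAV, 4.9 and Lemma 5.2 (1)–(4)]
[cite: Deligne1982HodgeCycles, §4 Prop. 4.4 and proof of Thm. 4.8, clauses (a)–(c) (Milne's TeXed ed., rev. 2018, pp. 32–35)] -/
theorem componentLadder_of_weilSystems_of_localVariationalHodgeFor_of_seedOn_member (hT : LocalVariationalHodgeFor 𝒪) {N d : ℕ}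
    {δ : weilNormResidueGroup d} {P : AbelianVariety ℂ} {ψ₀ : P ⟶ P} (hW : IsWeilType P ψ₀ N d) (e : ProjectiveEmbedding P.X)
    {a : complexBetti (projectiveSpace e.n ℂ) 2} (haQ : IsRationalClass a) (ha0 : a ≠ 0)
    (hδ : HasWeilDiscriminantNondeg P ψ₀ N d (symmetrisedClass d P ψ₀ e a) δ)
    {w : complexBetti P.X (2 * N)} (hwW : w ∈ weilClassesOf P ψ₀ N d) (hwQ : IsRationalClass w) (hw0 : w ≠ 0)
    (hS : HasSeedOn 𝒪 N P (symmetrisedClass d P ψ₀ e a) w) :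
    WeilClassesComponent N d δ ∧
      (∀ n : ℕ, 0 < n → n < N → ∀ δ' : weilNormResidueGroup d, WeilClassesComponent n d δ') ∧
      ∀ n : ℕ, 0 < n → n < N → WeilAlgebraicAll n d :=
  componentLadder_of_localVariationalHodgeFor_of_seedOn_member
    (weilFamilyReach_similar_of_polarizedWeilSystems_of_periodSurjective hPWS) hT hW e haQ ha0 hδ hwW hwQ hw0 hS

/-- **Component-free member form over ONE package** (`ComponentLadderG2nCofinal.below_of_localVariationalHodgeFor_of_seedOn_weilType` with the
reach binder REPLACED by the package): ONE seed on ANY Weil-type member at level `N` — its discriminant class not named — decides every component and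
`WeilAlgebraicAll` at every level `1 ≤ n < N`. [cite: vanGeemen1994HodgeAV, Lemma 5.2 (1)–(4)] [cite: Schoen1998HodgeWeilAddendum, 10 (Proposition), p. 332] -/
theorem below_of_weilSystems_of_localVariationalHodgeFor_of_seedOn_weilType (hT : LocalVariationalHodgeFor 𝒪) {N d : ℕ}
    {P : AbelianVariety ℂ} {ψ₀ : P ⟶ P} (hW : IsWeilType P ψ₀ N d) (e : ProjectiveEmbedding P.X)
    {a : complexBetti (projectiveSpace e.n ℂ) 2} (haQ : IsRationalClass a) (ha0 : a ≠ 0)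
    {w : complexBetti P.X (2 * N)} (hwW : w ∈ weilClassesOf P ψ₀ N d) (hwQ : IsRationalClass w) (hw0 : w ≠ 0)
    (hS : HasSeedOn 𝒪 N P (symmetrisedClass d P ψ₀ e a) w) :
    (∀ n : ℕ, 0 < n → n < N → ∀ δ' : weilNormResidueGroup d, WeilClassesComponent n d δ') ∧
      ∀ n : ℕ, 0 < n → n < N → WeilAlgebraicAll n d :=
  below_of_localVariationalHodgeFor_of_seedOn_weilType
    (weilFamilyReach_similar_of_polarizedWeilSystems_of_periodSurjective hPWS) hT hW e haQ ha0 hwW hwQ hw0 hS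

/-- **R∞ `WeilClassesImaginaryQuadratic` ⟸ the package ∧ `LocalVariationalHodgeFor 𝒪` ∧ COFINAL seeded members on ANY components**
(`ComponentLadderG2nCofinal.weilClassesImaginaryQuadratic_of_reach_of_localVariationalHodgeFor_of_cofinalSeededMembers` with the reach binder
REPLACED by the package). The honest terminus of the cell's strategy read uniformly in the level and the component, its family-theoretic input
now a constructor's obligation instead of a named fact; NOT `HC_AV`. Nothing is claimed: no cofinal supply of seeds exists, none on a deciding
component. [cite: Weil1977HodgeRing, §3] [cite: Markman2025SurveySecant, §4, §11.5 Steps 1–2 and §12 (preprint)]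
[cite: Schoen1998HodgeWeilAddendum, 10 (Proposition), p. 332] [cite: Deligne1982HodgeCycles, §4 Prop. 4.4 and proof of Thm. 4.8, clauses (a)–(c) (Milne's TeXed ed., rev. 2018, pp. 32–35)] -/
theorem weilClassesImaginaryQuadratic_of_weilSystems_of_localVariationalHodgeFor_of_cofinalSeededMembers
    (hT : LocalVariationalHodgeFor 𝒪)
    (hS : ∀ n : ℕ, 2 ≤ n → ∀ d : ℕ, 0 < d → ∃ (N : ℕ) (P : AbelianVariety ℂ) (ψ₀ : P ⟶ P) (e : ProjectiveEmbedding P.X)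
      (a : complexBetti (projectiveSpace e.n ℂ) 2) (w : complexBetti P.X (2 * N)),
      n < N ∧ IsWeilType P ψ₀ N d ∧ IsRationalClass a ∧ a ≠ 0 ∧ w ∈ weilClassesOf P ψ₀ N d ∧ IsRationalClass w ∧ w ≠ 0 ∧
        HasSeedOn 𝒪 N P (symmetrisedClass d P ψ₀ e a) w) :
    WeilClassesImaginaryQuadratic :=
  weilClassesImaginaryQuadratic_of_reach_of_localVariationalHodgeFor_of_cofinalSeededMembers
    (weilFamilyReach_similar_of_polarizedWeilSystems_of_periodSurjective hPWS) hT hS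

/-- **Seat p5's «consequences» tower over ONE package: R∞ ∧ F1 (Markman's fourfold statement, re-derived) ∧ R1 = stmt-2524 `WeilSixfolds` ∧ R1′
`NonsplitSixfolds` ∧ R2 `SplitWeilAbelianVarieties` ∧ (Moonen–Zarhin BY NAME) HC(dim ≤ 5)** ([Mar25b] Cor. 1.3 AS PRINTED, as an implication) —
`ComponentLadderG2nCofinal.ladder_of_moonenZarhin_of_reach_of_localVariationalHodgeFor_of_cofinalSeededMembers` with the reach binder REPLACED by the
package. The CM-field rung and `HC_AV` are NOT reached. [cite: Markman2025SurveySecant, Thm. 1.2, Cor. 1.3 and §12 (preprint)]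
[cite: MoonenZarhin1999LowDim, Thm. 0.1 and Thm. 0.2] [cite: Weil1977HodgeRing, §3] [cite: Schoen1998HodgeWeilAddendum, 10 (Proposition), p. 332] -/
theorem ladder_of_moonenZarhin_of_weilSystems_of_localVariationalHodgeFor_of_cofinalSeededMembers
    (hMZ : MoonenZarhin1999_hodgeClasses_abelian_dim_le_five_of_weilClassesFourfolds) (hT : LocalVariationalHodgeFor 𝒪)
    (hS : ∀ n : ℕ, 2 ≤ n → ∀ d : ℕ, 0 < d → ∃ (N : ℕ) (P : AbelianVariety ℂ) (ψ₀ : P ⟶ P) (e : ProjectiveEmbedding P.X)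
      (a : complexBetti (projectiveSpace e.n ℂ) 2) (w : complexBetti P.X (2 * N)),
      n < N ∧ IsWeilType P ψ₀ N d ∧ IsRationalClass a ∧ a ≠ 0 ∧ w ∈ weilClassesOf P ψ₀ N d ∧ IsRationalClass w ∧ w ≠ 0 ∧
        HasSeedOn 𝒪 N P (symmetrisedClass d P ψ₀ e a) w) :
    WeilClassesImaginaryQuadratic ∧ Markman2025_weilClasses_algebraic_abelianFourfold ∧ Theses.SevenfoldWeilCensus.WeilSixfolds ∧
      NonsplitSixfolds ∧ SplitWeilAbelianVarieties ∧ Theses.SevenfoldWeilCensus.HodgeAbelianDimLeFive :=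
  ladder_of_moonenZarhin_of_reach_of_localVariationalHodgeFor_of_cofinalSeededMembers hMZ
    (weilFamilyReach_similar_of_polarizedWeilSystems_of_periodSurjective hPWS) hT hS

/-- **Beyond dimension 5 over ONE package: cofinal seeded members on ANY components ⟹ the Hodge conjecture for EVERY GENERAL abelian variety of
Weil type with imaginary quadratic field** (`Ring2Transport.HodgeGeneralWeilType`, van Geemen Thm. 6.12; ring 2's binder-free theorems) —
`ComponentLadderG2nCofinal.hodgeGeneralWeilType_of_reach_of_localVariationalHodgeFor_of_cofinalSeededMembers` with the reach binder REPLACED by the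
package. NOT the special members, NOT CM fields of degree > 2, NOT `HC_AV`; nothing is claimed. [cite: vanGeemen1994HodgeAV, Thm. 4.11 and Thm. 6.11–6.12]
[cite: Weil1977HodgeRing, §3] [cite: Markman2025SurveySecant, §1.1 Question 1.1 and §12 (preprint)] -/
theorem hodgeGeneralWeilType_of_weilSystems_of_localVariationalHodgeFor_of_cofinalSeededMembers (hT : LocalVariationalHodgeFor 𝒪)
    (hS : ∀ n : ℕ, 2 ≤ n → ∀ d : ℕ, 0 < d → ∃ (N : ℕ) (P : AbelianVariety ℂ) (ψ₀ : P ⟶ P) (e : ProjectiveEmbedding P.X)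
      (a : complexBetti (projectiveSpace e.n ℂ) 2) (w : complexBetti P.X (2 * N)),
      n < N ∧ IsWeilType P ψ₀ N d ∧ IsRationalClass a ∧ a ≠ 0 ∧ w ∈ weilClassesOf P ψ₀ N d ∧ IsRationalClass w ∧ w ≠ 0 ∧
        HasSeedOn 𝒪 N P (symmetrisedClass d P ψ₀ e a) w) :
    Ring2Transport.HodgeGeneralWeilType :=
  hodgeGeneralWeilType_of_reach_of_localVariationalHodgeFor_of_cofinalSeededMembers
    (weilFamilyReach_similar_of_polarizedWeilSystems_of_periodSurjective hPWS) hT hS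

/-- **STRUCTURE (S4) in seat p10's spelling, existence clause on ANY component, over ONE package ⟹ R∞**
(`ComponentLadderG2nCofinal.weilClassesImaginaryQuadratic_of_s4Conjecture_seededMembers_of_reach_of_localVariationalHodgeFor` with the reach binder
REPLACED by the package). (S4) is the structure's OPEN conjecture — nothing is claimed; NOT `HC_AV`. [cite: Weil1977HodgeRing, §3]
[cite: Markman2025SurveySecant, §4 and §12 (preprint)] [cite: Schoen1998HodgeWeilAddendum, 10 (Proposition), p. 332] -/
theorem weilClassesImaginaryQuadratic_of_s4Conjecture_seededMembers_of_weilSystems_of_localVariationalHodgeFor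
    (hT : LocalVariationalHodgeFor 𝒪)
    (hS4 : S4Conjecture fun N ↦ ∀ d : ℕ, 0 < d → ∃ (P : AbelianVariety ℂ) (ψ₀ : P ⟶ P) (e : ProjectiveEmbedding P.X)
      (a : complexBetti (projectiveSpace e.n ℂ) 2) (w : complexBetti P.X (2 * N)),
      IsWeilType P ψ₀ N d ∧ IsRationalClass a ∧ a ≠ 0 ∧ w ∈ weilClassesOf P ψ₀ N d ∧ IsRationalClass w ∧ w ≠ 0 ∧
        HasSeedOn 𝒪 N P (symmetrisedClass d P ψ₀ e a) w) :
    WeilClassesImaginaryQuadratic :=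
  weilClassesImaginaryQuadratic_of_s4Conjecture_seededMembers_of_reach_of_localVariationalHodgeFor
    (weilFamilyReach_similar_of_polarizedWeilSystems_of_periodSurjective hPWS) hT hS4

/-! ## §3 Route (C) on real carriers over the package -/

/-- **Route (C), RANK door, over ONE package: cofinal seeded members of the real rank class ⟹ R∞** (p4's `PerfectComplexRankTransfer C` BY NAME —
ASSUMPTION of the venture; seeds of `rankObjClass C` BY VALUE; the package INLINE) —
`ComponentLadderG2nCofinal.weilClassesImaginaryQuadratic_of_reach_of_perfectComplexRankTransfer_of_cofinalSeededMembers` with the reach binder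
REPLACED by the package. [cite: BuchweitzFlenner2008HH, Prop. 6.4.4] [cite: Weil1977HodgeRing, §3] [cite: Schoen1998HodgeWeilAddendum, 10 (Proposition), p. 332] -/
theorem weilClassesImaginaryQuadratic_of_weilSystems_of_perfectComplexRankTransfer_of_cofinalSeededMembers (C : ChernCharacterBetti)
    (hT : PerfectComplexRankTransfer C)
    (hS : ∀ n : ℕ, 2 ≤ n → ∀ d : ℕ, 0 < d → ∃ (N : ℕ) (P : AbelianVariety ℂ) (ψ₀ : P ⟶ P) (e : ProjectiveEmbedding P.X)
      (a : complexBetti (projectiveSpace e.n ℂ) 2) (w : complexBetti P.X (2 * N)),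
      n < N ∧ IsWeilType P ψ₀ N d ∧ IsRationalClass a ∧ a ≠ 0 ∧ w ∈ weilClassesOf P ψ₀ N d ∧ IsRationalClass w ∧ w ≠ 0 ∧
        HasSeedOn (rankObjClass C) N P (symmetrisedClass d P ψ₀ e a) w) :
    WeilClassesImaginaryQuadratic :=
  weilClassesImaginaryQuadratic_of_reach_of_perfectComplexRankTransfer_of_cofinalSeededMembers C
    (weilFamilyReach_similar_of_polarizedWeilSystems_of_periodSurjective hPWS) hT hS

/-- **Route (C), σ-door, over ONE package: cofinal seeded members of the real σ-class ⟹ R∞** (t-7's `PerfectComplexSigmaTransfer C` BY NAME —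
ASSUMPTION; seeds of `sigmaObjClass C` BY VALUE; the package INLINE) —
`ComponentLadderG2nCofinal.weilClassesImaginaryQuadratic_of_reach_of_perfectComplexSigmaTransfer_of_cofinalSeededMembers` with the reach binder
REPLACED by the package. [claim: Perry2026Semiregularity, status: under-review] [cite: BuchweitzFlenner2003, Def. 4.1 and §5 (I-semiregular)]
[cite: Weil1977HodgeRing, §3] -/
theorem weilClassesImaginaryQuadratic_of_weilSystems_of_perfectComplexSigmaTransfer_of_cofinalSeededMembers (C : ChernCharacterBetti)
    (hT : PerfectComplexSigmaTransfer C)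
    (hS : ∀ n : ℕ, 2 ≤ n → ∀ d : ℕ, 0 < d → ∃ (N : ℕ) (P : AbelianVariety ℂ) (ψ₀ : P ⟶ P) (e : ProjectiveEmbedding P.X)
      (a : complexBetti (projectiveSpace e.n ℂ) 2) (w : complexBetti P.X (2 * N)),
      n < N ∧ IsWeilType P ψ₀ N d ∧ IsRationalClass a ∧ a ≠ 0 ∧ w ∈ weilClassesOf P ψ₀ N d ∧ IsRationalClass w ∧ w ≠ 0 ∧
        HasSeedOn (sigmaObjClass C) N P (symmetrisedClass d P ψ₀ e a) w) :
    WeilClassesImaginaryQuadratic :=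
  weilClassesImaginaryQuadratic_of_reach_of_perfectComplexSigmaTransfer_of_cofinalSeededMembers C
    (weilFamilyReach_similar_of_polarizedWeilSystems_of_periodSurjective hPWS) hT hS

/-! ## §4 The companions' SPLIT-anchored sentences over the package -/

/-- **The level-`N` SPLIT-anchored ladder over ONE package** (`ComponentLadderG2nCofinal.splitLadder_of_reachSimilar_of_localVariationalHodgeFor_of_hyperbolicSeedOn`
with the reach binder REPLACED by the package): BY NAME `LocalVariationalHodgeFor 𝒪`; BY VALUE ONE hyperbolic seed of class `𝒪` at level `N ≥ 1`
for `ℚ(√-d)`; INLINE the package ⟹ every split ℚ(√−d)-Weil `2N`-fold (`Stubs.WeilAlgebraicSplitHyperplane N d`) ∧ `WeilAlgebraicAll n d` for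
every `2 ≤ n < N`. [cite: Deligne1982HodgeCycles, §4 Cor. 4.2 and proof of Thm. 4.8, clauses (a)–(c) (Milne's TeXed ed., rev. 2018, pp. 32–35)]
[cite: Schoen1998HodgeWeilAddendum, §10] [cite: Markman2025SurveySecant, §11.5 Steps 1–2 (preprint)] -/
theorem splitLadder_of_weilSystems_of_localVariationalHodgeFor_of_hyperbolicSeedOn (hT : LocalVariationalHodgeFor 𝒪) {N d : ℕ}
    (hN : 1 ≤ N) (hd : 0 < d) (hS : HasHyperbolicSeedOn 𝒪 N d) :
    Stubs.WeilAlgebraicSplitHyperplane N d ∧ ∀ n : ℕ, 2 ≤ n → n < N → WeilAlgebraicAll n d :=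
  splitLadder_of_reachSimilar_of_localVariationalHodgeFor_of_hyperbolicSeedOn
    (weilFamilyReach_similar_of_polarizedWeilSystems_of_periodSurjective hPWS) hT hN hd hS

/-- **STRUCTURE (S4) with SPLIT seeds (seat p10's spelling, p11 g0's reading) over ONE package ⟹ R∞**
(`ComponentLadderG2nCofinal.weilClassesImaginaryQuadratic_of_s4Conjecture_of_reachSimilar_of_localVariationalHodgeFor` with the reach binder REPLACED
by the package). (S4) is OPEN; nothing is claimed; NOT `HC_AV`. [cite: Weil1977HodgeRing, §3] [cite: Markman2025SurveySecant, §4 and §12 (preprint)]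
[cite: Deligne1982HodgeCycles, §4 Cor. 4.2 and proof of Thm. 4.8, clauses (a)–(c) (Milne's TeXed ed., rev. 2018, pp. 32–35)] -/
theorem weilClassesImaginaryQuadratic_of_s4Conjecture_of_weilSystems_of_localVariationalHodgeFor (hT : LocalVariationalHodgeFor 𝒪)
    (hS4 : S4Conjecture fun N ↦ ∀ d : ℕ, 0 < d → HasHyperbolicSeedOn 𝒪 N d) : WeilClassesImaginaryQuadratic :=
  weilClassesImaginaryQuadratic_of_s4Conjecture_of_reachSimilar_of_localVariationalHodgeFor
    (weilFamilyReach_similar_of_polarizedWeilSystems_of_periodSurjective hPWS) hT hS4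

end OnePackage

/-! ## Audit: nothing is decided here
Every theorem carries (i) the package `hPWS` — a HYPOTHESIS on families (Deligne's polarized Weil systems through every Weil-type point,
period-surjective), inline, never asserted, not constructible in the tree today; (ii) BY NAME the transfer statement of the object class
(`LocalVariationalHodgeFor 𝒪`; in §1 the three doors' refereed transport facts; in §3 the venture's ASSUMPTIONS `PerfectComplexRankTransfer C` ∕
`PerfectComplexSigmaTransfer C`; Moonen–Zarhin in the tower); (iii) BY VALUE the seeds — the cell's computation targets, of which the signed
census supplies none on a deciding component. The two named reach facts are consumed INSIDE the proofs via s4-bridge-2's p368154 and remain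
unproved as closed statements. `HC_CM`, CM density, Mumford–Tate finiteness do not occur; NOT `HC_AV`. 0 `def`, 0 named fact, 0 `sorry`. -/

end Summit.Ventures.HSemireg

end
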